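import Literature.Probability.Percolation.DecisionTreeTying
import HarnessLib

/-!
# Coloured percolation: negative mutual dependence (Gladkov–Pak), and its decision-tree version
# (Gladkov 2024, Theorems 8.5, 8.6; Main Lemma 8.1)

Topic `Literature/Probability/Percolation`. Source: N. Gladkov, *Percolation Inequalities and Decision
Trees*, arXiv:2408.08457v2 (2024) [Gladkov2024], §8, pp. 15–16; the statement of Theorem 8.5 is
N. Gladkov, I. Pak, *Positive dependence for colored percolation*, Phys. Rev. E 109 (2024) L022101,
Theorem 1 (first part) [cited through Gladkov2024, "[GP24a, first part of Theorem 1]"].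

THE MODEL (p. 15, verbatim): "`f : E → {a, b, c, d}` is a uniform random coloring of the edges of `G`,
where each edge is colored uniformly and independently. Denote by `E_s`, `s ∈ {a,b,c,d}`, a subset of
edges of the corresponding color. Similarly, for every two distinct colors `s, t`, let `E_{st} := E_s ∪ E_t`.
One can think of `E_{st}` as either a `½`-percolation or a uniformly random subset of edges of `G`."
**Theorem 8.5** ([GP24a, first part of Theorem 1], p. 15, verbatim): "Let `U, V, W` be closed upward graph
properties. Denote by `U_ab, V_ac` and `W_bc` the corresponding properties of `G_ab, G_ac` and `G_bc`,
respectively. Then the events `U_ab, V_ac` and `W_bc` are pairwise independent, but have negative mutual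
dependence: `P(U_ab ∩ V_ac ∩ W_bc) ≤ P(U_ab)P(V_ac)P(W_bc)` (21)."  Proof idea (p. 16): "by the choice
of `Ω₁`, we see that `E₃ = E₁ ⊕ E₂` is an edgewise exclusive or of independent `E₁` and `E₂`, just like
`E_bc = E_ab ⊕ E_ac`."  **Theorem 8.6** (p. 16, verbatim; `Ω₁ = {000, 011, 101, 110}` with `μ₁` uniform
on it (`¼` each) and `Ω₂ = {0,1}³` with `μ₂` uniform (`⅛` each) — the printed sentence transposes the two
weights ("`μ₁` … assigning `⅛` … `μ₂` … assigns `¼`"), the printed case analysis (`μ₂({111}) = ⅛`,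
`μ₁({110}) = ¼`) fixes them as here): "Let `C₁`, `C` and `C₂` be the configurations built by decision
trees as above. Then `P(C₁ ∈ U×V) = P(C ∈ U×V) = P(C₂ ∈ U×V)` (22) and
`P(C₁ ∈ U×V×W) ≤ P(C ∈ U×V×W) ≤ P(C₂ ∈ U×V×W)` (23)."  The proof (p. 16) is the five-case check of
condition (18) ("up to the coordinate permutation"): `X₂ = ∅, {111}, {111,110}, {111,110,101,100}, Ω₂`
give `μ₁(X₁) = 0, 0, ¼, ½, 1 ≤ μ₂(X₂) = 0, ⅛, ¼, ½, 1`.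

WHAT IS HERE (all PROVED; `p = ½` throughout — the XOR structure is a fair-coin phenomenon):
* `Coloured.μxor` (= `μ₁`: weight `¼` on the triples with third bit = XOR of the first two, else `0`),
  `Coloured.μind` (= `μ₂`: weight `⅛`), nonnegativity, total mass one;
* `Coloured.caseCheck` (the printed check, all 27 increasing sections), **`Coloured.resampleLE`**
  (condition (18) for `U×V×W`, up-sets `U, V, W`);
* **`Coloured.thm86`** — (23): `Ex μxor 𝟙_{U×V×W} ≤ P_T(𝟙_{U×V×W}) ≤ Ex μind 𝟙_{U×V×W}` for every valid
  generating tree;  **`Coloured.thm85`** — (21) in the form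
  `E_{½⊗½}[𝟙_U(E₁) 𝟙_V(E₂) 𝟙_W(E₁ ⊕ E₂)] ≤ Ex (bern ½) 𝟙_U · Ex (bern ½) 𝟙_V · Ex (bern ½) 𝟙_W` (two
  independent fair bits per edge = the uniform 4-colouring; `E_ab = E₁`, `E_ac = E₂`, `E_bc = E₁ ⊕ E₂`), via
  `Coloured.ex_μxor_eq` (the left side is `Ex μxor 𝟙_{U×V×W}`, a push-forward `pushWeights`) and the
  three-fold Fubini `Richards.ex_prod₃` / two-block `Richards.ex_prod₂` for product weights (the right side
  is `Ex μind 𝟙_{U×V×W}`).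
Not here: the pairwise-independence clause (22) (each pair among `E₁, E₂, E₁ ⊕ E₂` is a pair of independent
fair configurations; `Richards.ex_prod₂`), the second part of [GP24a] Thm 1, decreasing events (for
down-sets (21) is REVERSED — inclusion–exclusion from the up-set case and pairwise independence — and
correspondingly (18) fails: `X = {000}` has `μ₁(X) = ¼ > ⅛ = μ₂(X)`; not transcribed).

## References
* N. Gladkov, *Percolation Inequalities and Decision Trees*, arXiv:2408.08457v2 (2024), Thms 8.5, 8.6. [Gladkov2024]
* N. Gladkov, I. Pak, *Positive dependence for colored percolation*, Phys. Rev. E 109 (2024) L022101, Thm 1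
  (via [Gladkov2024]).
-/

noncomputable section

open Classical

namespace Literature.Probability.Percolation

namespace DecisionTree

open Finset Function

variable {ι : Type*} [Fintype ι] [DecidableEq ι]

/-! ### A three-fold Fubini for product weights on `{0,1}³` -/

namespace Richards

/-- **Two independent blocks of coordinates**: for product weights `a i x.1 · b i x.2` on `β × γ` and a
product functional, `Ex` factorises: `Ex (a⊗b) (f∘fst · g∘snd) = Ex a f · Ex b g`. [folklore] -/
theorem ex_prod₂ {β γ : Type*} [Fintype β] [Fintype γ] (a : ι → β → ℝ) (b : ι → γ → ℝ)
    (f : (ι → β) → ℝ) (g : (ι → γ) → ℝ) :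
    Ex (fun i (x : β × γ) => a i x.1 * b i x.2) (fun C => f (fun i => (C i).1) * g (fun i => (C i).2)) =
      Ex a f * Ex b g := by
  simp only [Ex]
  rw [Fintype.sum_equiv (Equiv.arrowProdEquivProdArrow ι (fun _ => β) (fun _ => γ))
    (fun C : ι → β × γ => (∏ i, a i (C i).1 * b i (C i).2) * (f (fun i => (C i).1) * g (fun i => (C i).2)))
    (fun P : (ι → β) × (ι → γ) => ((∏ i, a i (P.1 i)) * f P.1) * ((∏ i, b i (P.2 i)) * g P.2))
    (fun C => by simp only [Equiv.arrowProdEquivProdArrow_apply, prod_mul_distrib]; ring)]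
  simp only [Fintype.sum_prod_type, sum_mul_sum]

/-- **Three independent coordinates**: for product weights `a i x.1 · b i x.2.1 · c i x.2.2` on `{0,1}³`
and a product functional, `Ex` factorises:
`Ex (a⊗b⊗c) (f ∘ proj₁ · g ∘ proj₂ · h ∘ proj₃) = Ex a f · Ex b g · Ex c h`. [folklore] -/
theorem ex_prod₃ (a b c : ι → Bool → ℝ) (f g h : (ι → Bool) → ℝ) :
    Ex (fun i (x : Bool × Bool × Bool) => a i x.1 * b i x.2.1 * c i x.2.2)
        (fun C => f (proj₁ C) * g (proj₂ C) * h (proj₃ C)) =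
      Ex a f * Ex b g * Ex c h := by
  have h₁ := ex_prod₂ a (fun i (y : Bool × Bool) => b i y.1 * c i y.2) f
    (fun D => g (fun i => (D i).1) * h (fun i => (D i).2))
  rw [ex_prod₂ b c g h] at h₁
  -- `proj₁ C = fun i => (C i).1` etc. definitionally
  change Ex (fun i (x : Bool × Bool × Bool) => a i x.1 * b i x.2.1 * c i x.2.2)
      (fun C => f (fun i => (C i).1) * g (fun i => (C i).2.1) * h (fun i => (C i).2.2)) = _
  simpa only [mul_assoc] using h₁

end Richards

namespace Coloured

/-! ### The two couplings of Theorem 8.6 -/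

/-- Gladkov's `μ₁` of Theorem 8.6: the uniform law on `Ω₁ = {000, 011, 101, 110}` — two independent fair
bits and their XOR ("`E₃ = E₁ ⊕ E₂` … just like `E_bc = E_ab ⊕ E_ac`"). [cite: Gladkov2024, Theorem 8.6 (p. 16)] -/
def μxor (_ : ι) (x : Bool × Bool × Bool) : ℝ := if x.2.2 = (x.1 ^^ x.2.1) then 1 / 4 else 0

/-- Gladkov's `μ₂` of Theorem 8.6: the uniform law on `Ω₂ = {0,1}³` (three independent fair bits).
[cite: Gladkov2024, Theorem 8.6 (p. 16)] -/
def μind (_ : ι) (_ : Bool × Bool × Bool) : ℝ := 1 / 8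

omit [Fintype ι] [DecidableEq ι] in
/-- `μxor ≥ 0`. [folklore] -/
theorem μxor_nonneg (i : ι) (x : Bool × Bool × Bool) : 0 ≤ μxor i x := by
  unfold μxor; split_ifs <;> norm_num

omit [Fintype ι] [DecidableEq ι] in
/-- `μind ≥ 0`. [folklore] -/
theorem μind_nonneg (i : ι) (x : Bool × Bool × Bool) : 0 ≤ μind i x := by
  unfold μind; norm_num

omit [Fintype ι] [DecidableEq ι] in
/-- `μxor` has total mass one. [folklore] -/
theorem sum_μxor (i : ι) : ∑ x, μxor i x = 1 := by
  simp only [Fintype.sum_prod_type, Fintype.sum_bool, μxor]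
  norm_num

omit [Fintype ι] [DecidableEq ι] in
/-- `μind` has total mass one. [folklore] -/
theorem sum_μind (i : ι) : ∑ x, μind i x = 1 := by
  simp only [Fintype.sum_prod_type, Fintype.sum_bool, μind]
  norm_num

omit [Fintype ι] [DecidableEq ι] in
/-- `μind` is the product of three fair-coin weights `bern ½`. [folklore] -/
theorem μind_eq (i : ι) (x : Bool × Bool × Bool) :
    μind i x = bern (fun _ : ι => (1 / 2 : ℝ)) i x.1 * bern (fun _ : ι => (1 / 2 : ℝ)) i x.2.1 *
      bern (fun _ : ι => (1 / 2 : ℝ)) i x.2.2 := by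
  unfold μind bern Richards.bw
  rcases x with ⟨b₁, b₂, b₃⟩
  cases b₁ <;> cases b₂ <;> cases b₃ <;> norm_num

/-! ### The printed five-case check (all 27 increasing sections) and condition (18) -/

omit [Fintype ι] [DecidableEq ι] in
/-- **The check of Theorem 8.6**: for increasing sections `X = X¹×X²×X³` (indicator patterns
`(0,0), (0,1), (1,1)` in each coordinate), `μ₁(X) ≤ μ₂(X)` — "`X₂ = {111}`: `0 < ⅛` … the only case where
the inequality is strict". [cite: Gladkov2024, Theorem 8.6 (proof, p. 16)] -/
theorem caseCheck {u v w : Bool → ℝ}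
    (hu : (u false = 0 ∧ u true = 0) ∨ (u false = 0 ∧ u true = 1) ∨ (u false = 1 ∧ u true = 1))
    (hv : (v false = 0 ∧ v true = 0) ∨ (v false = 0 ∧ v true = 1) ∨ (v false = 1 ∧ v true = 1))
    (hw : (w false = 0 ∧ w true = 0) ∨ (w false = 0 ∧ w true = 1) ∨ (w false = 1 ∧ w true = 1)) (i : ι) :
    ∑ x, μxor i x * (u x.1 * v x.2.1 * w x.2.2) ≤ ∑ x, μind i x * (u x.1 * v x.2.1 * w x.2.2) := by
  rcases hu with ⟨hu0, hu1⟩ | ⟨hu0, hu1⟩ | ⟨hu0, hu1⟩ <;>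
  rcases hv with ⟨hv0, hv1⟩ | ⟨hv0, hv1⟩ | ⟨hv0, hv1⟩ <;>
  rcases hw with ⟨hw0, hw1⟩ | ⟨hw0, hw1⟩ | ⟨hw0, hw1⟩ <;>
  simp [Fintype.sum_prod_type, μxor, μind, hu0, hu1, hv0, hv1, hw0, hw1] <;>
  norm_num

omit [Fintype ι] in
/-- **Condition (18) of Theorem 8.6**: for up-sets `U, V, W`, `ResampleLE μxor μind 𝟙_{U×V×W}`.
[cite: Gladkov2024, Theorem 8.6 (proof, p. 16)] -/
theorem resampleLE {U V W : Set (ι → Bool)} (hU : IsUpperSet U) (hV : IsUpperSet V) (hW : IsUpperSet W) :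
    ResampleLE (μxor : ι → Bool × Bool × Bool → ℝ) μind (ind (Richards.tripleEvent U V W)) := by
  intro C e
  simp_rw [Richards.ind_tripleEvent_update]
  exact caseCheck
    (u := fun b => if update (Richards.proj₁ C) e b ∈ U then 1 else 0)
    (v := fun b => if update (Richards.proj₂ C) e b ∈ V then 1 else 0)
    (w := fun b => if update (Richards.proj₃ C) e b ∈ W then 1 else 0)
    (Richards.pattern_inc hU (Richards.proj₁ C) e) (Richards.pattern_inc hV (Richards.proj₂ C) e)
    (Richards.pattern_inc hW (Richards.proj₃ C) e) e

/-! ### Theorems 8.6 and 8.5 -/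

/-- **Theorem 8.6 (decision-tree coloured percolation)**: for up-sets `U, V, W` and every generating tree
`T` valid on all edges (decision `false` = the edge's triple from `μ₁` = XOR-coupled fair bits, `true` =
from `μ₂` = three independent fair bits),
`P(C₁ ∈ U×V×W) ≤ P(C_T ∈ U×V×W) ≤ P(C₂ ∈ U×V×W)` — equation (23). [cite: Gladkov2024, Theorem 8.6 (23)] -/
theorem thm86 {U V W : Set (ι → Bool)} (hU : IsUpperSet U) (hV : IsUpperSet V) (hW : IsUpperSet W)
    {T : GTree ι (Bool × Bool × Bool)} (hT : T.ValidOn univ) (C : ι → Bool × Bool × Bool) :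
    Ex μxor (ind (Richards.tripleEvent U V W)) ≤ T.eval μxor μind univ (ind (Richards.tripleEvent U V W)) C ∧
      T.eval μxor μind univ (ind (Richards.tripleEvent U V W)) C ≤ Ex μind (ind (Richards.tripleEvent U V W)) :=
  ⟨GTree.ex_le_eval (resampleLE hU hV hW) μxor_nonneg μind_nonneg hT C,
    GTree.eval_le_ex (resampleLE hU hV hW) μxor_nonneg μind_nonneg hT C⟩

/-- The XOR-coupled expectation is the two-fair-coins ("uniform 4-colouring") expectation of
`F(E₁) G(E₂) H(E₁ ⊕ E₂)`:
`Ex μxor (f∘proj₁ · g∘proj₂ · h∘proj₃) = Ex (bern ½ ⊗ bern ½) ((E₁,E₂) ↦ f E₁ · g E₂ · h (E₁ ⊕ E₂))`, where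
`⊕` is the edgewise XOR — "`E_bc = E_ab ⊕ E_ac`". [cite: Gladkov2024, Theorem 8.6 (proof, p. 16)] -/
theorem ex_μxor_eq (f g h : (ι → Bool) → ℝ) :
    Ex (μxor : ι → Bool × Bool × Bool → ℝ)
        (fun C => f (Richards.proj₁ C) * g (Richards.proj₂ C) * h (Richards.proj₃ C)) =
      Ex (fun i (y : Bool × Bool) => bern (fun _ : ι => (1 / 2 : ℝ)) i y.1 * bern (fun _ : ι => (1 / 2 : ℝ)) i y.2)
        (fun D => f (fun i => (D i).1) * g (fun i => (D i).2) * h (fun i => ((D i).1 ^^ (D i).2))) := by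
  have hw : (μxor : ι → Bool × Bool × Bool → ℝ) =
      pushWeights (fun (_ : ι) (y : Bool × Bool) => (y.1, y.2, (y.1 ^^ y.2)))
        (fun i (y : Bool × Bool) =>
          bern (fun _ : ι => (1 / 2 : ℝ)) i y.1 * bern (fun _ : ι => (1 / 2 : ℝ)) i y.2) := by
    funext i x
    unfold μxor pushWeights bern Richards.bw
    rcases x with ⟨b₁, b₂, b₃⟩
    simp only [Fintype.sum_prod_type, Fintype.sum_bool, Prod.mk.injEq]
    cases b₁ <;> cases b₂ <;> cases b₃ <;> norm_num
  rw [hw, ex_pushWeights]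
  rfl

/-- **Theorem 8.5 (Gladkov–Pak: negative mutual dependence for coloured percolation).**  For up-sets
`U, V, W` of `{0,1}^ι` ("closed upward graph properties") and the uniform 4-colouring encoded by two
independent fair bits per edge (`E_ab = E₁`, `E_ac = E₂`, `E_bc = E₁ ⊕ E₂`, each a fair percolation):
`P(U_ab ∩ V_ac ∩ W_bc) ≤ P(U_ab) P(V_ac) P(W_bc)` — the right side written with the single fair
percolation law `Ex (bern ½)` of each `E_{st}`. [cite: Gladkov2024, Theorem 8.5 (21) and Theorem 8.6] -/
theorem thm85 {U V W : Set (ι → Bool)} (hU : IsUpperSet U) (hV : IsUpperSet V) (hW : IsUpperSet W) :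
    Ex (fun i (y : Bool × Bool) => bern (fun _ : ι => (1 / 2 : ℝ)) i y.1 * bern (fun _ : ι => (1 / 2 : ℝ)) i y.2)
        (fun D => ind U (fun i => (D i).1) * ind V (fun i => (D i).2) *
          ind W (fun i => ((D i).1 ^^ (D i).2))) ≤
      Ex (bern fun _ : ι => (1 / 2 : ℝ)) (ind U) * Ex (bern fun _ : ι => (1 / 2 : ℝ)) (ind V) *
        Ex (bern fun _ : ι => (1 / 2 : ℝ)) (ind W) := by
  -- left side = `Ex μxor 𝟙_{U×V×W}` (push-forward), right side = `Ex μind 𝟙_{U×V×W}` (three-fold Fubini)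
  have hind : (ind (Richards.tripleEvent U V W) : (ι → Bool × Bool × Bool) → ℝ) =
      fun C => ind U (Richards.proj₁ C) * ind V (Richards.proj₂ C) * ind W (Richards.proj₃ C) := by
    funext C
    unfold ind Richards.tripleEvent
    by_cases h₁ : Richards.proj₁ C ∈ U <;> by_cases h₂ : Richards.proj₂ C ∈ V <;>
      by_cases h₃ : Richards.proj₃ C ∈ W <;> simp [h₁, h₂, h₃]
  have hμ : (μind : ι → Bool × Bool × Bool → ℝ) = fun i x =>
      bern (fun _ : ι => (1 / 2 : ℝ)) i x.1 * bern (fun _ : ι => (1 / 2 : ℝ)) i x.2.1 *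
        bern (fun _ : ι => (1 / 2 : ℝ)) i x.2.2 :=
    funext fun i => funext fun x => μind_eq i x
  have key := ex_le_ex (resampleLE hU hV hW) (μxor_nonneg (ι := ι)) μind_nonneg
  rw [hind, ex_μxor_eq, hμ, Richards.ex_prod₃] at key
  exact key

end Coloured

end DecisionTree

end Literature.Probability.Percolation

end
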